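import Mathlib
import HarnessLib
import Literature.MathematicalPhysics.QuantumLattice.KohnLuttingerLindhardMeasurable

/-!
# Route `WeakCouplingBCS` — certificate half of stmt-HubbardSuperconductivity-0158, item «(E2)-TPRIME-LINDHARD-BOUND» (pen (R460)(A)), towards (N2) = (SV):
# the shell volume of the `t`–`t′` band REDUCED TO A ONE-DIMENSIONAL INTEGRAL of explicit `arccos` slice lengths (chart-free; scope memo §8)

Cell `gate-hubbard-kl`, seat p4 (g23); zero kit; no definitions.  For `|t′| < 1/2` write `ε_{t′}(x, y) = −2cos x − A·cos y` with `A = 2 + 4t′cos x > 0` and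
`g = −(μ + 2cos x)/A`; the `x`-slice of the shell `BZ ∩ {|ε_{t′} − μ| < t}` is `{y ∈ [−π, π) : |cos y − g| < t/A}`, of length `≤ 2·(arccos (g − t/A) − arccos (g + t/A))`
(`volume_abs_cos_sub_lt_inter_Icc_le`, the `Icc` twin of …KlShellSliceTrig §1), so by Fubini
* **`kltp_shellVolume_le_lintegral_slices`** — `vol(BZ ∩ {|ε_{t′} − μ| < t}) ≤ ∫⁻_{x ∈ [−π,π]} 2·(arccos (g(x) − t/A(x)) − arccos (g(x) + t/A(x))) dx`.
What remains for (SV) `≤ C_sh·t` on the record's box is the estimate of this explicit integral (memo §8 (ii)+(iv): `arccos_sub_arccos_le_div_sqrt` off the crossings of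
the Fermi curve with `y = ±π`, `arccos_sub_arccos_le_two_sqrt` + transversality near them).  Nothing here asserts (SV) for any `t′`, a record, a margin, `K₃`, `U₀`, the
window or superconductivity.  [folklore]
-/

noncomputable section

-- the tree's namespace `Summit.<Summit>.<Problem>.Theorems` repeats the summit name by design (D-0017)
set_option linter.dupNamespace false

namespace Summit.HubbardSuperconductivity.HubbardSuperconductivity.Theorems

open Real Set MeasureTheory MeasureTheory.Measure Literature.MathematicalPhysics.QuantumLattice
open scoped ENNReal

/-! ### §1 The slice length on the closed period `[−π, π]` -/

/-- `λ({y ∈ [−π, π] : |cos y − g| < τ}) ≤ 2·(arccos (g − τ) − arccos (g + τ))` (the `Icc` twin of `volume_abs_cos_sub_lt_inter_Ioc_le`). [folklore] -/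
theorem volume_abs_cos_sub_lt_inter_Icc_le (g τ : ℝ) :
    volume ({y : ℝ | |cos y - g| < τ} ∩ Icc (-π) π) ≤ ENNReal.ofReal (2 * (arccos (g - τ) - arccos (g + τ))) := by
  rcases le_or_gt τ 0 with hτ | hτ
  · have hempty : {y : ℝ | |cos y - g| < τ} ∩ Icc (-π) π = ∅ := by
      ext y
      simp only [mem_inter_iff, mem_setOf_eq, mem_empty_iff_false, iff_false, not_and]
      intro h; exact absurd (h.trans_le hτ) (not_lt.2 (abs_nonneg _))
    rw [hempty, measure_empty]; exact bot_le
  set a : ℝ := arccos (g + τ) with ha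
  set b : ℝ := arccos (g - τ) with hb
  have hsub : {y : ℝ | |cos y - g| < τ} ∩ Icc (-π) π ⊆ Icc a b ∪ Icc (-b) (-a) := by
    rintro y ⟨hy, hyI⟩
    rw [mem_setOf_eq, abs_lt] at hy
    obtain ⟨h1, h2⟩ := hy
    have hc1 : g - τ ≤ cos y := by linarith
    have hc2 : cos y ≤ g + τ := by linarith
    rcases le_or_gt 0 y with hy0 | hy0
    · left
      have hyc : arccos (cos y) = y := arccos_cos hy0 hyI.2
      refine ⟨?_, ?_⟩
      · rw [ha, ← hyc]; exact arccos_le_arccos hc2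
      · rw [hb, ← hyc]; exact arccos_le_arccos hc1
    · right
      have hyc : arccos (cos (-y)) = -y := arccos_cos (by linarith) (by linarith [hyI.1])
      rw [cos_neg] at hyc
      refine ⟨?_, ?_⟩
      · rw [hb, neg_le, ← hyc]; exact arccos_le_arccos hc1
      · rw [ha, le_neg, ← hyc]; exact arccos_le_arccos hc2
  have hab : a ≤ b := by rw [ha, hb]; exact arccos_le_arccos (by linarith)
  calc volume ({y : ℝ | |cos y - g| < τ} ∩ Icc (-π) π) ≤ volume (Icc a b ∪ Icc (-b) (-a)) := measure_mono hsub
    _ ≤ volume (Icc a b) + volume (Icc (-b) (-a)) := measure_union_le _ _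
    _ = ENNReal.ofReal (b - a) + ENNReal.ofReal (-a - -b) := by rw [Real.volume_Icc, Real.volume_Icc]
    _ = ENNReal.ofReal (2 * (b - a)) := by
        rw [← ENNReal.ofReal_add (by linarith) (by linarith)]; congr 1; ring

/-! ### §2 The shell as the preimage of a planar set, and its slices -/

/-- The shell `BZ ∩ {|ε_{t′} − μ| < t}` is the preimage under `k ↦ (k₀, k₁)` of an explicit planar set. [folklore] -/
theorem kltp_shell_eq_preimage (tp μ t : ℝ) :
    brillouinZone ∩ {p : Momentum | |squareDispersion 1 tp p - μ| < t} =
      (fun k : Momentum => ((k 0, k 1) : ℝ × ℝ)) ⁻¹'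
        {x : ℝ × ℝ | (x.1 ∈ Ico (-π) π ∧ x.2 ∈ Ico (-π) π) ∧ |-2 * 1 * (Real.cos x.1 + Real.cos x.2) - 4 * tp * Real.cos x.1 * Real.cos x.2 - μ| < t} := by
  ext k
  simp only [brillouinZone, mem_inter_iff, mem_setOf_eq, mem_preimage, Fin.forall_fin_two, squareDispersion]

/-- The planar shell set is measurable. [folklore] -/
theorem kltp_measurableSet_planarShell (tp μ t : ℝ) :
    MeasurableSet {x : ℝ × ℝ | (x.1 ∈ Ico (-π) π ∧ x.2 ∈ Ico (-π) π) ∧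
      |-2 * 1 * (Real.cos x.1 + Real.cos x.2) - 4 * tp * Real.cos x.1 * Real.cos x.2 - μ| < t} := by
  have h1 : MeasurableSet {x : ℝ × ℝ | x.1 ∈ Ico (-π) π ∧ x.2 ∈ Ico (-π) π} := by
    have : {x : ℝ × ℝ | x.1 ∈ Ico (-π) π ∧ x.2 ∈ Ico (-π) π} = Ico (-π) π ×ˢ Ico (-π) π := by ext x; simp [mem_prod]
    rw [this]; exact measurableSet_Ico.prod measurableSet_Ico
  have hc : Continuous fun x : ℝ × ℝ => |-2 * 1 * (Real.cos x.1 + Real.cos x.2) - 4 * tp * Real.cos x.1 * Real.cos x.2 - μ| := by fun_prop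
  exact h1.inter (measurableSet_lt hc.measurable measurable_const)

/-- **The `x`-slice of the shell is a cosine-sublevel set**: for `|t′| < 1/2`, with `A = 2 + 4t′cos x > 0` and `g = −(μ + 2cos x)/A`, the slice lies in
`{y : |cos y − g| < t/A} ∩ [−π, π]`. [folklore] -/
theorem kltp_shell_slice_subset {tp : ℝ} (htp : |tp| < 1 / 2) (μ t x : ℝ) :
    (Prod.mk x ⁻¹' {z : ℝ × ℝ | (z.1 ∈ Ico (-π) π ∧ z.2 ∈ Ico (-π) π) ∧
        |-2 * 1 * (Real.cos z.1 + Real.cos z.2) - 4 * tp * Real.cos z.1 * Real.cos z.2 - μ| < t}) ⊆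
      {y : ℝ | |cos y - (-(μ + 2 * cos x) / (2 + 4 * tp * cos x))| < t / (2 + 4 * tp * cos x)} ∩ Icc (-π) π := by
  have hcoef : 0 < 2 + 4 * tp * cos x := by
    have h1 : |4 * tp * cos x| ≤ 4 * |tp| := by
      rw [abs_mul, abs_mul, abs_of_pos (by norm_num : (0 : ℝ) < 4)]
      exact mul_le_of_le_one_right (by positivity) (abs_cos_le_one x)
    have h2 : -(4 * |tp|) ≤ 4 * tp * cos x := (neg_le_neg h1).trans (neg_abs_le _)
    linarith
  rintro y ⟨⟨-, hy⟩, h⟩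
  simp only at hy h
  refine ⟨?_, Ico_subset_Icc_self hy⟩
  simp only [mem_setOf_eq]
  have hne : 2 + 4 * tp * cos x ≠ 0 := hcoef.ne'
  rw [lt_div_iff₀ hcoef]
  have habs : |cos y - -(μ + 2 * cos x) / (2 + 4 * tp * cos x)| * (2 + 4 * tp * cos x) =
      |(cos y - -(μ + 2 * cos x) / (2 + 4 * tp * cos x)) * (2 + 4 * tp * cos x)| := by
    rw [abs_mul, abs_of_pos hcoef]
  have hmul : (cos y - -(μ + 2 * cos x) / (2 + 4 * tp * cos x)) * (2 + 4 * tp * cos x) =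
      -(-2 * 1 * (cos x + cos y) - 4 * tp * cos x * cos y - μ) := by
    rw [sub_mul, div_mul_cancel₀ _ hne]
    ring
  rw [habs, hmul, abs_neg]
  exact h

/-! ### §3 The shell volume as a one-dimensional integral of slice lengths -/

/-- **The shell volume of the `t`–`t′` band is at most the integral of the explicit slice lengths** (`|t′| < 1/2`, every `μ`, `t`):
`vol(BZ ∩ {|ε_{t′} − μ| < t}) ≤ ∫⁻_{[−π,π]} 2·(arccos (g(x) − t/A(x)) − arccos (g(x) + t/A(x))) dx`, `A = 2 + 4t′cos x`, `g = −(μ + 2cos x)/A`. [folklore] -/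
theorem kltp_shellVolume_le_lintegral_slices {tp : ℝ} (htp : |tp| < 1 / 2) (μ t : ℝ) :
    volume (brillouinZone ∩ {p : Momentum | |squareDispersion 1 tp p - μ| < t}) ≤
      ∫⁻ x in Icc (-π) π, ENNReal.ofReal (2 * (arccos (-(μ + 2 * cos x) / (2 + 4 * tp * cos x) - t / (2 + 4 * tp * cos x)) -
        arccos (-(μ + 2 * cos x) / (2 + 4 * tp * cos x) + t / (2 + 4 * tp * cos x)))) := by
  set T : Set (ℝ × ℝ) := {z : ℝ × ℝ | (z.1 ∈ Ico (-π) π ∧ z.2 ∈ Ico (-π) π) ∧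
    |-2 * 1 * (Real.cos z.1 + Real.cos z.2) - 4 * tp * Real.cos z.1 * Real.cos z.2 - μ| < t} with hT
  have hTm : MeasurableSet T := kltp_measurableSet_planarShell tp μ t
  rw [kltp_shell_eq_preimage, measurePreserving_momentum_prod.measure_preimage hTm.nullMeasurableSet]
  rw [show (volume : Measure (ℝ × ℝ)) = (volume : Measure ℝ).prod volume from rfl, Measure.prod_apply hTm]
  -- slices outside `x ∈ [−π, π)` are empty; inside they are cosine-sublevel sets
  set F : ℝ → ℝ≥0∞ := fun x => ENNReal.ofReal (2 * (arccos (-(μ + 2 * cos x) / (2 + 4 * tp * cos x) - t / (2 + 4 * tp * cos x)) -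
    arccos (-(μ + 2 * cos x) / (2 + 4 * tp * cos x) + t / (2 + 4 * tp * cos x)))) with hF
  have hpt : ∀ x, volume (Prod.mk x ⁻¹' T) ≤ (Icc (-π) π).indicator F x := by
    intro x
    by_cases hx : x ∈ Ico (-π) π
    · rw [indicator_of_mem (Ico_subset_Icc_self hx)]
      exact (measure_mono (kltp_shell_slice_subset htp μ t x)).trans (volume_abs_cos_sub_lt_inter_Icc_le _ _)
    · have hempty : Prod.mk x ⁻¹' T = ∅ := by
        ext y
        simp only [hT, mem_preimage, mem_setOf_eq, mem_empty_iff_false, iff_false, not_and]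
        intro h; exact absurd h.1 hx
      rw [hempty, measure_empty]; exact bot_le
  calc ∫⁻ x, volume (Prod.mk x ⁻¹' T) ≤ ∫⁻ x, (Icc (-π) π).indicator F x := lintegral_mono hpt
    _ = ∫⁻ x in Icc (-π) π, F x := lintegral_indicator measurableSet_Icc F

end Summit.HubbardSuperconductivity.HubbardSuperconductivity.Theorems

end
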